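import Literature.AlgebraicGeometry.Motives.ZarhinHodgeGroupAutC
import HarnessLib

/-!
# Automorphisms of `ℂ` fixing the intersection of two number fields: the Galois correspondence for `E₀ ∩ E₁`

For two subfields `E₀, E₁ ⊂ ℂ` of finite degree over `ℚ` write `Aut(ℂ/E) = {σ ∈ Aut(ℂ) | σ|_E = id}`.  The classical
Galois correspondence inside a finite Galois extension `C/ℚ` containing `E₀E₁` says that the subgroup belonging to
`E₀ ∩ E₁` is the subgroup GENERATED by the subgroups belonging to `E₀` and to `E₁`
(`Gal(C/E₀ ∩ E₁) = ⟨Gal(C/E₀), Gal(C/E₁)⟩`, the lattice anti-isomorphism).  Since every automorphism of the countable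
field `C` extends to `ℂ` (the tree's `Motives.ZarhinLie.exists_ringEquiv_complex_comp_eq`) and `Aut(ℂ/C) ⊆ Aut(ℂ/E₀)`,
the same statement holds for the (huge) group `Aut(ℂ)`:

* **`mem_closure_fixing_union_iff`** — `τ ∈ ⟨Aut(ℂ/E₀) ∪ Aut(ℂ/E₁)⟩ ⟺ τ` fixes `E₀ ∩ E₁` pointwise; the two directions
  `apply_eq_of_mem_closure_fixing_union` (trivial) and `mem_closure_fixing_union_of_apply_eq`;
* **`conj_mem_closure_fixing_union_iff`** — in particular complex conjugation is a product of automorphisms of `ℂ` each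
  fixing `E₀` or `E₁` pointwise iff `E₀ ∩ E₁ ⊂ ℝ` (for conjugation-stable `E_i`, e.g. images of CM fields: iff the number
  field `E₀ ∩ E₁` is totally real).

This is the field-theoretic input of the criterion "the REFLEX FIELDS of two CM types meet in a totally real field"
for the additivity of Mumford–Tate ranks (`Summits/HodgeConjecture/CorCM/ReflexStabilizersCMHodge`: the stabiliser of a
CM type `Φ` in `Aut(ℂ)` is `Aut(ℂ/K*)`, `K*` the reflex field).  Companion of
`Literature/NumberTheory/ComplexMultiplication/PartialConjugationOfRealIntersection` (NORMAL `A`, `B`: gluing `g|_A`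
with `id_B`); here `E₀`, `E₁` are arbitrary and only generation is claimed.  Theorems only; no definition, no `sorry`.

Instance hygiene as there: an intermediate field `S` of `ℂ/ℚ` carries Mathlib's `IntermediateField.algebra'` and the
generic `DivisionRing.toRatAlgebra`; the proofs pin the former with `letI`.

## References

* [Lang2002] S. Lang, *Algebra*, 3rd ed., GTM 211, VI §1 Thm. 1.1 and Cor. 1.6 (the Galois correspondence is a lattice
  anti-isomorphism: `E₀ ∩ E₁ ↔` the group generated), V §2 Thm. 2.8 (extension of embeddings into algebraically
  closed fields).
-/

noncomputable section

open IntermediateField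

namespace Literature.NumberTheory.NumberFields

section Closure

variable {E₀ E₁ : IntermediateField ℚ ℂ}

/-- A finite-dimensional intermediate field of `ℂ/ℚ` is countable. [folklore] -/
private theorem countable_of_finiteDimensional'' (C : IntermediateField ℚ ℂ) [FiniteDimensional ℚ C] :
    Countable C :=
  Countable.of_equiv _ (Module.finBasis ℚ C).equivFun.toEquiv.symm

/-- An automorphism of `ℂ` fixes `ℚ`. [folklore] -/
private theorem ringEquiv_apply_algebraMap'' (g : ℂ ≃+* ℂ) (q : ℚ) : g (algebraMap ℚ ℂ q) = algebraMap ℚ ℂ q := by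
  rw [eq_ratCast]
  exact map_ratCast g q

/-- **Trivial direction**: a product of automorphisms of `ℂ` each fixing `E₀` or `E₁` pointwise fixes `E₀ ∩ E₁`
pointwise. [cite: Lang2002, VI §1 Thm. 1.1] -/
theorem apply_eq_of_mem_closure_fixing_union {τ : ℂ ≃+* ℂ}
    (hτ : τ ∈ Subgroup.closure
      ({σ : ℂ ≃+* ℂ | ∀ x : ℂ, x ∈ E₀ → σ x = x} ∪ {σ : ℂ ≃+* ℂ | ∀ x : ℂ, x ∈ E₁ → σ x = x}))
    {x : ℂ} (h₀ : x ∈ E₀) (h₁ : x ∈ E₁) : τ x = x := by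
  induction hτ using Subgroup.closure_induction with
  | mem σ hσ => exact hσ.elim (fun h => h x h₀) (fun h => h x h₁)
  | one => rfl
  | mul σ σ' _ _ ih ih' => rw [RingAut.mul_apply, ih', ih]
  | inv σ _ ih =>
    rw [RingAut.inv_apply, RingEquiv.symm_apply_eq]
    exact ih.symm

/-- **The subgroup of `Aut(ℂ)` fixing `E₀ ∩ E₁` pointwise is generated by `Aut(ℂ/E₀)` and `Aut(ℂ/E₁)`** (`E₀`, `E₁`
subfields of `ℂ` of finite degree): if `τ ∈ Aut(ℂ)` fixes `E₀ ∩ E₁` pointwise then `τ` is a product of automorphisms of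
`ℂ` each fixing `E₀` or `E₁` pointwise.  Proof: in the normal closure `C` of `E₀E₁` in `ℂ` (finite Galois over `ℚ`) the
restriction `τ|_C` lies in `Gal(C/E₀ ∩ E₁) = ⟨Gal(C/E₀), Gal(C/E₁)⟩` (Galois correspondence); every element of
`Gal(C/E_i)` is the restriction of an element of `Aut(ℂ/E_i)` (extension from the countable field `C`), and the kernel
of restriction `Aut(ℂ/C)` lies in `Aut(ℂ/E₀)`. [cite: Lang2002, VI §1 Thm. 1.1, Cor. 1.6 and V §2 Thm. 2.8] -/
theorem mem_closure_fixing_union_of_apply_eq [FiniteDimensional ℚ E₀] [FiniteDimensional ℚ E₁] {τ : ℂ ≃+* ℂ}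
    (hτ : ∀ x : ℂ, x ∈ E₀ → x ∈ E₁ → τ x = x) :
    τ ∈ Subgroup.closure
      ({σ : ℂ ≃+* ℂ | ∀ x : ℂ, x ∈ E₀ → σ x = x} ∪ {σ : ℂ ≃+* ℂ | ∀ x : ℂ, x ∈ E₁ → σ x = x}) := by
  classical
  set T : Subgroup (ℂ ≃+* ℂ) := Subgroup.closure
      ({σ : ℂ ≃+* ℂ | ∀ x : ℂ, x ∈ E₀ → σ x = x} ∪ {σ : ℂ ≃+* ℂ | ∀ x : ℂ, x ∈ E₁ → σ x = x}) with hT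
  -- pin the `ℚ`-algebra structures (see the module docstring)
  letI i01 : Algebra ℚ ↥(E₀ ⊔ E₁) := IntermediateField.algebra' _
  -- the normal closure `C` of `E₀ ⊔ E₁` in `ℂ`: finite Galois over `ℚ`, containing `E₀` and `E₁`
  let C : IntermediateField ℚ ℂ := normalClosure ℚ ↥(E₀ ⊔ E₁) ℂ
  letI iC : Algebra ℚ ↥C := IntermediateField.algebra' C
  have h0C : E₀ ≤ C := (le_sup_left : E₀ ≤ E₀ ⊔ E₁).trans (IntermediateField.le_normalClosure _)
  have h1C : E₁ ≤ C := (le_sup_right : E₁ ≤ E₀ ⊔ E₁).trans (IntermediateField.le_normalClosure _)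
  haveI : Normal ℚ ↥C := by
    haveI := Algebra.IsAlgebraic.isNormalClosure_normalClosure (F := ℚ) (K := ↥(E₀ ⊔ E₁)) (L := ℂ)
      fun x => IsAlgClosed.splits _
    exact IsNormalClosure.normal (K := ↥(E₀ ⊔ E₁))
  haveI : Algebra.IsSeparable ℚ (↥C) := Algebra.IsAlgebraic.isSeparable_of_perfectField
  haveI : IsGalois ℚ (↥C) := ⟨⟩
  haveI : Countable ↥C := countable_of_finiteDimensional'' C
  -- `E₀`, `E₁` as intermediate fields of `C/ℚ`
  let E₀' : IntermediateField ℚ ↥C := IntermediateField.restrict h0C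
  let E₁' : IntermediateField ℚ ↥C := IntermediateField.restrict h1C
  -- restriction of automorphisms of `ℂ` to the normal subfield `C`
  let res : (ℂ ≃+* ℂ) → (↥C ≃ₐ[ℚ] ↥C) := fun σ =>
    (AlgEquiv.ofRingEquiv (f := σ) (ringEquiv_apply_algebraMap'' σ)).restrictNormal ↥C
  have hres : ∀ (σ : ℂ ≃+* ℂ) (x : ↥C), ((res σ x : ↥C) : ℂ) = σ x := fun σ x =>
    AlgEquiv.restrictNormal_commutes (AlgEquiv.ofRingEquiv (f := σ) (ringEquiv_apply_algebraMap'' σ)) ↥C x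
  -- (1) `τ|_C` fixes `E₀' ∩ E₁'`
  have hfix : res τ ∈ (E₀' ⊓ E₁').fixingSubgroup := by
    rw [IntermediateField.mem_fixingSubgroup_iff]
    intro x hx
    apply Subtype.ext
    rw [hres]
    exact hτ x ((IntermediateField.mem_restrict h0C x).1 hx.1) ((IntermediateField.mem_restrict h1C x).1 hx.2)
  -- (2) Galois correspondence in `C/ℚ`: `Gal(C/E₀' ∩ E₁') ≤ Gal(C/E₀') ⊔ Gal(C/E₁')`
  have hle : (E₀' ⊓ E₁').fixingSubgroup ≤ E₀'.fixingSubgroup ⊔ E₁'.fixingSubgroup := by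
    have hK : IntermediateField.fixedField (E₀'.fixingSubgroup ⊔ E₁'.fixingSubgroup) ≤ E₀' ⊓ E₁' :=
      le_inf
        ((IntermediateField.fixedField_le le_sup_left).trans (IsGalois.fixedField_fixingSubgroup E₀').le)
        ((IntermediateField.fixedField_le le_sup_right).trans (IsGalois.fixedField_fixingSubgroup E₁').le)
    exact (IntermediateField.fixingSubgroup_le hK).trans (IntermediateField.fixingSubgroup_fixedField _).le
  have hmem : res τ ∈ Subgroup.closure
      ((E₀'.fixingSubgroup : Set (↥C ≃ₐ[ℚ] ↥C)) ∪ (E₁'.fixingSubgroup : Set (↥C ≃ₐ[ℚ] ↥C))) := by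
    rw [← Subgroup.sup_eq_closure]
    exact hle hfix
  -- (3) lifting along `res`: every element of `⟨Gal(C/E₀'), Gal(C/E₁')⟩` has all its extensions to `ℂ` in `T`
  have key : ∀ γ ∈ Subgroup.closure
      ((E₀'.fixingSubgroup : Set (↥C ≃ₐ[ℚ] ↥C)) ∪ (E₁'.fixingSubgroup : Set (↥C ≃ₐ[ℚ] ↥C))),
      ∀ σ : ℂ ≃+* ℂ, (∀ x : ↥C, σ x = ((γ x : ↥C) : ℂ)) → σ ∈ T := by
    intro γ hγ
    induction hγ using Subgroup.closure_induction with
    | mem γ hγ =>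
      intro σ hσ
      rcases hγ with h | h
      · refine Subgroup.subset_closure (Or.inl fun x hx => ?_)
        have e := (IntermediateField.mem_fixingSubgroup_iff _ _).1 h ⟨x, h0C hx⟩
          ((IntermediateField.mem_restrict h0C _).2 hx)
        rw [hσ ⟨x, h0C hx⟩, e]
      · refine Subgroup.subset_closure (Or.inr fun x hx => ?_)
        have e := (IntermediateField.mem_fixingSubgroup_iff _ _).1 h ⟨x, h1C hx⟩
          ((IntermediateField.mem_restrict h1C _).2 hx)
        rw [hσ ⟨x, h1C hx⟩, e]
    | one =>
      intro σ hσ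
      refine Subgroup.subset_closure (Or.inl fun x hx => ?_)
      rw [hσ ⟨x, h0C hx⟩, AlgEquiv.one_apply]
    | mul γ₁ γ₂ _ _ ih₁ ih₂ =>
      intro σ hσ
      -- extend `γ₂` to an automorphism `σ₂` of `ℂ`; then `σ σ₂⁻¹` extends `γ₁`
      obtain ⟨σ₂, hσ₂⟩ := Literature.AlgebraicGeometry.Motives.ZarhinLie.exists_ringEquiv_complex_comp_eq
        (algebraMap (↥C) ℂ) ((algebraMap (↥C) ℂ).comp γ₂.toRingEquiv.toRingHom)
      have h2 : ∀ x : ↥C, σ₂ x = ((γ₂ x : ↥C) : ℂ) := fun x => hσ₂ x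
      have h1 : ∀ x : ↥C, (σ * σ₂⁻¹) x = ((γ₁ x : ↥C) : ℂ) := by
        intro x
        have e : σ₂.symm (x : ℂ) = ((γ₂.symm x : ↥C) : ℂ) := by
          rw [RingEquiv.symm_apply_eq, h2, AlgEquiv.apply_symm_apply]
        rw [RingAut.mul_apply, RingAut.inv_apply, e, hσ, AlgEquiv.mul_apply, AlgEquiv.apply_symm_apply]
      have hprod : σ * σ₂⁻¹ * σ₂ = σ := by rw [inv_mul_cancel_right]
      rw [← hprod]
      exact T.mul_mem (ih₁ _ h1) (ih₂ _ h2)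
    | inv γ _ ih =>
      intro σ hσ
      have h : ∀ x : ↥C, σ⁻¹ x = ((γ x : ↥C) : ℂ) := by
        intro x
        rw [RingAut.inv_apply, RingEquiv.symm_apply_eq, hσ, AlgEquiv.aut_inv, AlgEquiv.symm_apply_apply]
      exact (Subgroup.inv_mem_iff T).1 (ih _ h)
  exact key _ hmem τ fun x => (hres τ x).symm

/-- **Galois correspondence for `Aut(ℂ)` at `E₀ ∩ E₁`**: `τ` is a product of automorphisms of `ℂ` each fixing `E₀`
or `E₁` pointwise iff `τ` fixes `E₀ ∩ E₁` pointwise. [cite: Lang2002, VI §1 Thm. 1.1 and Cor. 1.6] -/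
theorem mem_closure_fixing_union_iff [FiniteDimensional ℚ E₀] [FiniteDimensional ℚ E₁] (τ : ℂ ≃+* ℂ) :
    τ ∈ Subgroup.closure
        ({σ : ℂ ≃+* ℂ | ∀ x : ℂ, x ∈ E₀ → σ x = x} ∪ {σ : ℂ ≃+* ℂ | ∀ x : ℂ, x ∈ E₁ → σ x = x}) ↔
      ∀ x : ℂ, x ∈ E₀ → x ∈ E₁ → τ x = x :=
  ⟨fun h _ h₀ h₁ => apply_eq_of_mem_closure_fixing_union h h₀ h₁, mem_closure_fixing_union_of_apply_eq⟩

/-- **Complex conjugation is generated by `Aut(ℂ/E₀)` and `Aut(ℂ/E₁)` iff `E₀ ∩ E₁ ⊂ ℝ`** (iff conjugation fixes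
`E₀ ∩ E₁` pointwise; for conjugation-stable `E₀`, `E₁` — e.g. images of CM fields — iff the field `E₀ ∩ E₁` is totally
real). [cite: Lang2002, VI §1 Thm. 1.1 and Cor. 1.6] -/
theorem conj_mem_closure_fixing_union_iff [FiniteDimensional ℚ E₀] [FiniteDimensional ℚ E₁] :
    (starRingAut : ℂ ≃+* ℂ) ∈ Subgroup.closure
        ({σ : ℂ ≃+* ℂ | ∀ x : ℂ, x ∈ E₀ → σ x = x} ∪ {σ : ℂ ≃+* ℂ | ∀ x : ℂ, x ∈ E₁ → σ x = x}) ↔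
      ∀ x : ℂ, x ∈ E₀ → x ∈ E₁ → starRingEnd ℂ x = x := by
  rw [mem_closure_fixing_union_iff]
  simp only [starRingAut_apply, starRingEnd_apply]

/-- The set `Aut(ℂ/E)` only grows when `E` shrinks: if `E ≤ E'` then every automorphism fixing `E'` pointwise fixes `E`
pointwise — so the criterion is inherited by any pair of larger fields `E₀' ⊇ E₀`, `E₁' ⊇ E₁` (closure is monotone).
[cite: Lang2002, VI §1 Thm. 1.1] -/
theorem closure_fixing_union_mono {E₀' E₁' : IntermediateField ℚ ℂ} (h₀ : E₀ ≤ E₀') (h₁ : E₁ ≤ E₁') :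
    Subgroup.closure
        ({σ : ℂ ≃+* ℂ | ∀ x : ℂ, x ∈ E₀' → σ x = x} ∪ {σ : ℂ ≃+* ℂ | ∀ x : ℂ, x ∈ E₁' → σ x = x}) ≤
      Subgroup.closure
        ({σ : ℂ ≃+* ℂ | ∀ x : ℂ, x ∈ E₀ → σ x = x} ∪ {σ : ℂ ≃+* ℂ | ∀ x : ℂ, x ∈ E₁ → σ x = x}) :=
  Subgroup.closure_mono (Set.union_subset_union (fun _ hσ x hx => hσ x (h₀ hx)) (fun _ hσ x hx => hσ x (h₁ hx)))

end Closure

end Literature.NumberTheory.NumberFields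

end
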